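import Summits.RiemannHypothesis.RiemannHypothesis.Theses.SpectralTrace
import HarnessLib

/-!
# Crux `SpectralThesis` (stmt-RiemannHypothesis-0187), line `Sketch` — stub `stub_density`, toolbox

Real-analysis toolbox for the density `ν_A` of `stub_density`
(`Theorems/SpectralTraceSpectralThesisStubDensity.lean`): integrability of `log(1+x²)/(1+x²)` and
of the log-singularity majorant `max(0, −log x²)`, the change of variables
`A ∫ k(A(t−s)) f(s) ds = ∫ k(u) f(t − u/A) du`, `L¹`-type bounds for kernels `|k| ≤ C/(1+x²)`,
continuity and differentiation under the integral sign for the two convolution shapes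
`∫ k(u) f(t − u/A) du` (smooth bounded `f'`) and `∫ k(A(t−s)) b(s) ds` (kernel differentiated,
`b` bounded), and integrability of `ĝ · w` from `‖ĝ‖ ≤ C/(1+t²)²`, `|w| ≤ a(1+t²)`.
-/

noncomputable section

set_option linter.dupNamespace false
set_option autoImplicit false

open Complex Set MeasureTheory Filter
open scoped Real ContDiff Topology

namespace Summit.RiemannHypothesis.RiemannHypothesis.Theorems.SpectralThesis.Sketch

open Literature.NumberTheory.LFunctions

namespace Density

/-- `log(1+x²)/(1+x²)` is integrable on `ℝ` (it is `≤ 4(1+x²)^{-3/4}`). [folklore] -/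
theorem integrable_log_div : Integrable (fun x : ℝ => Real.log (1 + x ^ 2) / (1 + x ^ 2)) := by
  have h := (integrable_rpow_neg_one_add_norm_sq (E := ℝ) (μ := volume) (r := 3 / 2)
    (by simp; norm_num)).const_mul 4
  have hp : ∀ x : ℝ, (0 : ℝ) < 1 + x ^ 2 := fun x => by positivity
  have h1c : Continuous fun x : ℝ => 1 + x ^ 2 := by fun_prop
  have hc : Continuous fun x : ℝ => Real.log (1 + x ^ 2) / (1 + x ^ 2) :=
    (h1c.log fun x => (hp x).ne').div h1c fun x => (hp x).ne'
  refine h.mono' hc.aestronglyMeasurable (Eventually.of_forall fun x => ?_)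
  have hx : 0 < 1 + x ^ 2 := by positivity
  have hlog : 0 ≤ Real.log (1 + x ^ 2) := Real.log_nonneg (by nlinarith)
  rw [Real.norm_eq_abs, abs_of_nonneg (div_nonneg hlog hx.le)]
  have h1 : Real.log (1 + x ^ 2) ≤ (1 + x ^ 2) ^ (1 / 4 : ℝ) / (1 / 4) :=
    Real.log_le_rpow_div hx.le (by norm_num)
  simp only [Real.norm_eq_abs, sq_abs]
  calc Real.log (1 + x ^ 2) / (1 + x ^ 2) ≤ ((1 + x ^ 2) ^ (1 / 4 : ℝ) / (1 / 4)) / (1 + x ^ 2) :=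
        div_le_div_of_nonneg_right h1 hx.le
    _ = 4 * ((1 + x ^ 2) ^ (1 / 4 : ℝ) * (1 + x ^ 2) ^ (-1 : ℝ)) := by
        rw [Real.rpow_neg_one]; ring
    _ = 4 * (1 + x ^ 2) ^ (-(3 / 2) / 2 : ℝ) := by
        rw [← Real.rpow_add hx]; norm_num

/-- `P₀(x) = max 0 (−log x²)` (the integrable log-singularity majorant) is integrable. [folklore] -/
theorem integrable_posLog : Integrable (fun x : ℝ => max 0 (-Real.log (x ^ 2))) := by
  have heq : (fun x : ℝ => max 0 (-Real.log (x ^ 2))) =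
      (Set.Icc (-1 : ℝ) 1).indicator (fun x => -2 * Real.log x) := by
    funext x
    rw [Real.log_pow]
    by_cases hx : x ∈ Set.Icc (-1 : ℝ) 1
    · rw [Set.indicator_of_mem hx]
      have : Real.log x ≤ 0 := by
        rw [← Real.log_abs]; exact Real.log_nonpos (abs_nonneg x) (abs_le.2 hx)
      push_cast
      rw [max_eq_right (by linarith)]; ring
    · rw [Set.indicator_of_notMem hx]
      have : 0 ≤ Real.log x := by
        rw [← Real.log_abs]
        refine Real.log_nonneg ?_
        simp only [Set.mem_Icc, not_and_or, not_le] at hx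
        rcases hx with h | h
        · rw [abs_of_neg (by linarith)]; linarith
        · rw [abs_of_pos (by linarith)]; linarith
      push_cast
      rw [max_eq_left (by linarith)]
  rw [heq, integrable_indicator_iff measurableSet_Icc]
  have h := (intervalIntegral.intervalIntegrable_log' (a := (-1 : ℝ)) (b := 1)).const_mul (-2)
  rw [intervalIntegrable_iff_integrableOn_Ioc_of_le (by norm_num)] at h
  exact (integrableOn_Icc_iff_integrableOn_Ioc (f := fun x : ℝ => -2 * Real.log x)).2 h

/-- Change of variables `u = A(t − s)`: `A ∫ k(A(t−s)) f(s) ds = ∫ k(u) f(t − u/A) du`. [folklore] -/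
theorem dilate_subst (k f : ℝ → ℝ) {A : ℝ} (hA : 0 < A) (t : ℝ) :
    A * ∫ s, k (A * (t - s)) * f s = ∫ u, k u * f (t - u / A) := by
  have h1 : ∫ s, k (A * (t - s)) * f s = ∫ s, k (A * s) * f (t - s) := by
    rw [← integral_sub_left_eq_self (fun s => k (A * s) * f (t - s)) volume t]
    congr 1 with s
    simp [sub_sub_cancel]
  have h2 : ∫ s, k (A * s) * f (t - s) = ∫ s, (fun u => k u * f (t - u / A)) (A * s) := by
    congr 1 with s
    simp [mul_div_cancel_left₀ _ hA.ne']
  rw [h1, h2, Measure.integral_comp_mul_left (fun u => k u * f (t - u / A)) A, abs_inv,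
    abs_of_pos hA, smul_eq_mul, ← mul_assoc, mul_inv_cancel₀ hA.ne', one_mul]

/-- `|∫ k(u) f(t − u/A) du| ≤ C M π` when `|k| ≤ C/(1+u²)` and `|f| ≤ M`. [folklore] -/
theorem abs_integral_mul_shift_le {k f : ℝ → ℝ} {C : ℝ} (hkb : ∀ u, |k u| ≤ C / (1 + u ^ 2))
    {M : ℝ} (hM : ∀ x, |f x| ≤ M) (A t : ℝ) :
    |∫ u, k u * f (t - u / A)| ≤ C * M * π := by
  have hMn : 0 ≤ M := (abs_nonneg _).trans (hM 0)
  have hi : Integrable fun u : ℝ => C * M * (1 + u ^ 2)⁻¹ := integrable_inv_one_add_sq.const_mul _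
  have h := norm_integral_le_of_norm_le hi (f := fun u => k u * f (t - u / A))
    (Eventually.of_forall fun u => by
      rw [Real.norm_eq_abs, abs_mul]
      have hpos : (0 : ℝ) < 1 + u ^ 2 := by positivity
      have hk0 : 0 ≤ C / (1 + u ^ 2) := (abs_nonneg _).trans (hkb u)
      calc |k u| * |f (t - u / A)| ≤ C / (1 + u ^ 2) * M :=
            mul_le_mul (hkb u) (hM _) (abs_nonneg _) hk0
        _ = C * M * (1 + u ^ 2)⁻¹ := by rw [div_eq_mul_inv]; ring)
  rw [Real.norm_eq_abs] at h
  refine h.trans_eq ?_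
  rw [integral_const_mul, integral_univ_inv_one_add_sq]

/-- Dilated form: `|A ∫ k(A(t−s)) b(s) ds| ≤ C B π`. [folklore] -/
theorem abs_dilate_integral_le {k b : ℝ → ℝ} {C : ℝ} (hkb : ∀ x, |k x| ≤ C / (1 + x ^ 2))
    {B : ℝ} (hB : ∀ s, |b s| ≤ B) {A : ℝ} (hA : 0 < A) (t : ℝ) :
    |A * ∫ s, k (A * (t - s)) * b s| ≤ C * B * π := by
  rw [dilate_subst k b hA t]
  exact abs_integral_mul_shift_le hkb hB A t

/-- Continuity of `t ↦ ∫ k(u) f(t − u/A) du` for integrable `k` and bounded continuous `f`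
(dominated convergence). [folklore] -/
theorem continuous_integral_shift {k f : ℝ → ℝ} (hk : Integrable k) (hf : Continuous f) {M : ℝ}
    (hM : ∀ x, |f x| ≤ M) (A : ℝ) : Continuous fun t => ∫ u, k u * f (t - u / A) := by
  refine continuous_of_dominated (F := fun t u => k u * f (t - u / A))
    (bound := fun u => ‖k u‖ * M) (fun t => ?_) (fun t => Eventually.of_forall fun u => ?_)
    (hk.norm.mul_const M) (Eventually.of_forall fun u => ?_)
  · exact hk.aestronglyMeasurable.mul
      (hf.comp (continuous_const.sub (continuous_id.div_const A))).aestronglyMeasurable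
  · rw [norm_mul, Real.norm_eq_abs, Real.norm_eq_abs]
    exact mul_le_mul_of_nonneg_left (hM _) (abs_nonneg _)
  · exact continuous_const.mul (hf.comp (continuous_id.sub continuous_const))

/-- Differentiation under the integral sign, smooth factor: `d/dt ∫ k(u) f(t−u/A) du =
∫ k(u) f'(t−u/A) du` for integrable `k` and `f ∈ C¹` with bounded continuous `f'`. [folklore] -/
theorem hasDerivAt_integral_shift {k f f' : ℝ → ℝ} (hk : Integrable k)
    (hf : ∀ x, HasDerivAt f (f' x) x) (hf'c : Continuous f') {M : ℝ} (hM : ∀ x, |f' x| ≤ M)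
    (A : ℝ) (hint : ∀ t, Integrable (fun u => k u * f (t - u / A))) (t : ℝ) :
    HasDerivAt (fun t => ∫ u, k u * f (t - u / A)) (∫ u, k u * f' (t - u / A)) t := by
  have h := hasDerivAt_integral_of_dominated_loc_of_deriv_le (μ := volume) (x₀ := t)
    (F := fun t u => k u * f (t - u / A)) (F' := fun t u => k u * f' (t - u / A))
    (bound := fun u => |k u| * M) (Metric.ball_mem_nhds t one_pos)
    (Eventually.of_forall fun t' => (hint t').aestronglyMeasurable) (hint t)
    (hk.aestronglyMeasurable.mul
      (hf'c.comp (continuous_const.sub (continuous_id.div_const A))).aestronglyMeasurable)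
    (Eventually.of_forall fun u t' _ => by
      rw [Real.norm_eq_abs, abs_mul]
      exact mul_le_mul_of_nonneg_left (hM _) (abs_nonneg _))
    (hk.abs.mul_const M)
    (Eventually.of_forall fun u t' _ =>
      (HasDerivAt.comp_sub_const t' (u / A) (hf (t' - u / A))).const_mul (k u))
  exact h.2

/-- Differentiation under the integral sign, kernel factor: `d/dt ∫ k(A(t−s)) b(s) ds =
∫ A k'(A(t−s)) b(s) ds` for `k ∈ C¹` with `k, k' = O(1/(1+x²))` and `b` bounded continuous.
[folklore] -/
theorem hasDerivAt_integral_kernel {k k' b : ℝ → ℝ} (hk : ∀ x, HasDerivAt k (k' x) x)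
    (hk'c : Continuous k') {C : ℝ} (hkb : ∀ x, |k x| ≤ C / (1 + x ^ 2))
    (hk'b : ∀ x, |k' x| ≤ C / (1 + x ^ 2)) (hb : Continuous b) {B : ℝ} (hB : ∀ s, |b s| ≤ B)
    {A : ℝ} (hA : 0 < A) (t : ℝ) :
    HasDerivAt (fun t => ∫ s, k (A * (t - s)) * b s) (∫ s, A * k' (A * (t - s)) * b s) t := by
  have hkc : Continuous k := continuous_iff_continuousAt.2 fun x => (hk x).continuousAt
  have hBn : 0 ≤ B := (abs_nonneg _).trans (hB 0)
  have hI : ∀ c : ℝ, Integrable (fun s => c * (1 + (A * (t - s)) ^ 2)⁻¹) := fun c =>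
    ((integrable_inv_one_add_sq.comp_mul_left' hA.ne').comp_sub_left t).const_mul c
  have h := hasDerivAt_integral_of_dominated_loc_of_deriv_le (μ := volume) (x₀ := t)
    (F := fun t s => k (A * (t - s)) * b s) (F' := fun t s => A * k' (A * (t - s)) * b s)
    (bound := fun s => A * C * B * (2 * (1 + 2 * A ^ 2)) * (1 + (A * (t - s)) ^ 2)⁻¹)
    (Metric.ball_mem_nhds t one_pos) ?_ ?_ ?_ ?_ (hI _) ?_
  · exact h.2
  · exact Eventually.of_forall fun t' =>
      (by fun_prop : Continuous fun s => k (A * (t' - s)) * b s).aestronglyMeasurable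
  · refine (hI (C * B)).mono'
      (by fun_prop : Continuous fun s => k (A * (t - s)) * b s).aestronglyMeasurable
      (Eventually.of_forall fun s => ?_)
    rw [Real.norm_eq_abs, abs_mul]
    have hk0 : 0 ≤ C / (1 + (A * (t - s)) ^ 2) := (abs_nonneg _).trans (hkb _)
    calc |k (A * (t - s))| * |b s| ≤ C / (1 + (A * (t - s)) ^ 2) * B :=
          mul_le_mul (hkb _) (hB _) (abs_nonneg _) hk0
      _ = C * B * (1 + (A * (t - s)) ^ 2)⁻¹ := by rw [div_eq_mul_inv]; ring
  · exact (by fun_prop : Continuous fun s => A * k' (A * (t - s)) * b s).aestronglyMeasurable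
  · refine Eventually.of_forall fun s t' ht' => ?_
    have hd : |t' - t| < 1 := by simpa [Real.dist_eq] using ht'
    have hd2 : (t' - t) ^ 2 ≤ 1 := by
      have h1 := abs_lt.1 hd
      nlinarith
    have hpos1 : (0 : ℝ) < 1 + (A * (t' - s)) ^ 2 := by positivity
    have hpos2 : (0 : ℝ) < 1 + (A * (t - s)) ^ 2 := by positivity
    have key : (1 + (A * (t' - s)) ^ 2)⁻¹ ≤
        (2 * (1 + 2 * A ^ 2)) * (1 + (A * (t - s)) ^ 2)⁻¹ := by
      rw [inv_eq_one_div, inv_eq_one_div, mul_one_div, div_le_div_iff₀ hpos1 hpos2, one_mul]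
      have hδ : (A * (t - t')) ^ 2 ≤ A ^ 2 := by
        rw [mul_pow]; nlinarith [sq_nonneg A, sq_nonneg (t - t')]
      nlinarith [sq_nonneg (A * (t' - s) - A * (t - t')), sq_nonneg (A * (t' - s)), sq_nonneg A,
        mul_nonneg (sq_nonneg A) (sq_nonneg (A * (t' - s)))]
    have hk0 : 0 ≤ C / (1 + (A * (t' - s)) ^ 2) := (abs_nonneg _).trans (hk'b _)
    rw [Real.norm_eq_abs, abs_mul, abs_mul, abs_of_pos hA]
    calc A * |k' (A * (t' - s))| * |b s| ≤ A * (C / (1 + (A * (t' - s)) ^ 2)) * B := by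
          refine mul_le_mul (mul_le_mul_of_nonneg_left (hk'b _) hA.le) (hB _) (abs_nonneg _) ?_
          exact mul_nonneg hA.le hk0
      _ = A * C * B * (1 + (A * (t' - s)) ^ 2)⁻¹ := by rw [div_eq_mul_inv]; ring
      _ ≤ A * C * B * ((2 * (1 + 2 * A ^ 2)) * (1 + (A * (t - s)) ^ 2)⁻¹) := by
          refine mul_le_mul_of_nonneg_left key ?_
          have hC : 0 ≤ C := by
            have := hk0
            rwa [le_div_iff₀ hpos1, zero_mul] at this
          positivity
      _ = _ := by ring
  · refine Eventually.of_forall fun s t' _ => ?_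
    have h1 : HasDerivAt (fun t : ℝ => A * (t - s)) A t' := by
      simpa using ((hasDerivAt_id t').sub_const s).const_mul A
    have h2 : HasDerivAt (fun t : ℝ => k (A * (t - s)) * b s) (k' (A * (t' - s)) * A * b s) t' :=
      ((hk (A * (t' - s))).comp t' h1).mul_const (b s)
    exact h2.congr_deriv (by ring)

/-- Integrability of `ĝ · w` on the critical line from `‖ĝ(t)‖ ≤ C/(1+t²)²` and
`|w(t)| ≤ a(1+t²)`. [folklore] -/
theorem integrable_mul_of_decay {F : ℝ → ℂ} (hF : Continuous F) {Cg : ℝ}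
    (hFb : ∀ t, ‖F t‖ ≤ Cg / (1 + t ^ 2) ^ 2) {w : ℝ → ℝ} (hw : Continuous w) {a : ℝ}
    (hwb : ∀ t, |w t| ≤ a * (1 + t ^ 2)) : Integrable (fun t => F t * (w t : ℂ)) := by
  refine Integrable.mono' (integrable_inv_one_add_sq.const_mul (Cg * a))
    (hF.mul (continuous_ofReal.comp hw)).aestronglyMeasurable (Eventually.of_forall fun t => ?_)
  have hpos : (0 : ℝ) < 1 + t ^ 2 := by positivity
  have hF0 : 0 ≤ Cg / (1 + t ^ 2) ^ 2 := (norm_nonneg _).trans (hFb t)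
  rw [norm_mul, Complex.norm_real, Real.norm_eq_abs]
  calc ‖F t‖ * |w t| ≤ Cg / (1 + t ^ 2) ^ 2 * (a * (1 + t ^ 2)) :=
        mul_le_mul (hFb t) (hwb t) (abs_nonneg _) hF0
    _ = Cg * a * (1 + t ^ 2)⁻¹ := by field_simp

/-! ### Landing anchor -/

/-- **Landing anchor of this auxiliary file** (registered sub-goal `stub_density_aux1` of item
stmt-RiemannHypothesis-0187, stub `stub_density`): binder-free restatement of
`hasDerivAt_integral_kernel` (differentiation of `∫ k(A(t−s)) b(s) ds` under the integral sign).
[folklore] -/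
theorem stub_density_aux1 : ∀ (k k' b : ℝ → ℝ) (C B A : ℝ), (∀ x, HasDerivAt k (k' x) x) →
    Continuous k' → (∀ x, |k x| ≤ C / (1 + x ^ 2)) → (∀ x, |k' x| ≤ C / (1 + x ^ 2)) →
    Continuous b → (∀ s, |b s| ≤ B) → 0 < A →
    ∀ t : ℝ, HasDerivAt (fun t => ∫ s, k (A * (t - s)) * b s) (∫ s, A * k' (A * (t - s)) * b s) t :=
  fun _ _ _ _ _ _ hk hk'c hkb hk'b hb hB hA t => hasDerivAt_integral_kernel hk hk'c hkb hk'b hb hB hA t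

end Density

end Summit.RiemannHypothesis.RiemannHypothesis.Theorems.SpectralThesis.Sketch

end
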